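import Literature.Geometry.Riemannian.RicciFlowScaledChartBounds
import Literature.Geometry.Riemannian.CurvatureDerivativeNormSq
import HarnessLib

/-!
# The scaled metric `G/(T − t)` in a chart: uniform bounds and the Cauchy property as `t ↑ T`
(topic `Geometry/Riemannian`)

Consequences of `RicciFlowScaledChartBounds.lean` (Hamilton 1982, §14, Lemma 14.2; §17,
Cor. 17.10: in charts the normalised metrics `g̃(t) = g(t)/(T − t)` have bounded coordinate
derivatives of all orders which converge uniformly as `t ↑ T`):

* `MetricCoord.scaled_iteratedFDeriv_bounded_and_cauchy` — for a coordinate Ricci flow with the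
  decay data of `spatiallyBddUpTo_scaled_of_covariantRicciDecay` on `B(y₀, r') × (t₁, T)`, every
  `∂ᵐ_y G̃(·, t)` is bounded there and uniformly Cauchy as `t ↑ T`: the scaled flow equation
  `∂ₜG̃ = −2(T − t)⁻¹(Ric(G) − G/(2(T − t)))` (`deriv_inv_smul_of_flow`) has right-hand side
  `(T − t)^{ε−1} · (bounded up to order m)` (the weighted defect, reconstructed from its
  components), and `dYk_cauchy_of_dT_rpow` integrates the rate `(T − t)^{ε−1}`.
* `IsRicciFlow.scaledChartRep_bounded_and_cauchy` — the manifold form: along a Ricci flow on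
  `[0, T)`, chart data at every point (two-sided bounds of `G̃ = (T − t)⁻¹ chartRep I g z t`, decay
  of the Einstein defect and of all components of `∇ᵏ⁺¹Ric` on a closed chart ball
  `B̄(ẑ, r) × [t₁, T)`) give, on `B(ẑ, r/2)` and `[(t₁ + T)/2, T)`, bounds on all
  `∂ᵐ_y G̃(·, t)` and their uniform Cauchy property (`isMetricFamilyOn_chartRep_of`,
  `tDeriv_chartRep_eq_of` read the flow in the chart).

No named fact is introduced; everything in this file is proved.

## References

* R. S. Hamilton, *Three-manifolds with positive Ricci curvature*, J. Differential Geom. 17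
  (1982) 255–306, §14, Lemma 14.2; §17, Cor. 17.10. [Hamilton1982]
* P. Topping, *Lectures on the Ricci flow*, LMS Lecture Note Series 325, CUP 2006, proof of
  Thm. 5.3.1, pp. 47–48. [Topping2006]
* B. Chow, D. Knopf, *The Ricci flow: an introduction*, AMS 2004, §6.7. [ChowKnopf2004]
-/

noncomputable section

set_option maxSynthPendingDepth 3

open Bundle Set Filter Function Metric Real Module
open scoped Manifold ContDiff Topology

namespace Literature.Geometry.Lorentzian

namespace MetricCoord

open Literature.Analysis.Calculus

universe u

variable {E : Type u} [NormedAddCommGroup E] [NormedSpace ℝ E] [FiniteDimensional ℝ E] [CompleteSpace E]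
  {ι : Type*} [Fintype ι]

/-- **Uniform bounds and the Cauchy property as `t ↑ T` for the scaled metric in a chart**
(Hamilton 1982, §14, Lemma 14.2; §17, Cor. 17.10): under the hypotheses of
`spatiallyBddUpTo_scaled_of_covariantRicciDecay`, for every order `m` the iterated spatial
derivatives `∂ᵐ_y G̃(·, t)` are bounded on `B(y₀, r') × (t₁, T)` and uniformly Cauchy as `t ↑ T`:
`∂ₜ G̃ = −2(T−t)⁻¹ D = (T−t)^{ε−1} · (bounded up to order m)` with the weighted defect
`D = Ric(G) − G/(2(T−t))`, and `dYk_cauchy_of_dT_rpow` integrates the rate `(T − t)^{ε−1}`.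
[cite: Hamilton1982, §14, Lemma 14.2] [cite: Hamilton1982, §17, Cor. 17.10] -/
theorem scaled_iteratedFDeriv_bounded_and_cauchy (b : Basis ι ℝ E)
    {G : ℝ → E → E →L[ℝ] E →L[ℝ] ℝ} {V : Set E} {T : ℝ}
    (hfam : IsMetricFamilyOn G (Ico 0 T) V)
    (hfl : ∀ t ∈ Ico 0 T, ∀ y ∈ V, tDeriv G (Ico 0 T) t y = (-2 : ℝ) • ricAt (G t) y)
    {y₀ : E} {r r' : ℝ} (hr'r : r' < r) (hball : ball y₀ r ⊆ V) {t₁ : ℝ} (ht₁ : t₁ ∈ Ico 0 T)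
    {Λ lam : ℝ} (hlam : 0 < lam)
    (hΛ : ∀ q ∈ ball y₀ r' ×ˢ Ioo t₁ T, ‖(T - q.2)⁻¹ • G q.2 q.1‖ ≤ Λ)
    (hpos : ∀ q ∈ ball y₀ r' ×ˢ Ioo t₁ T, ∀ v : E, lam * ‖v‖ ^ 2 ≤ (T - q.2)⁻¹ * G q.2 q.1 v v)
    {δ₀ C₀ : ℝ} (hδ₀ : 0 < δ₀)
    (hD : ∀ q ∈ ball y₀ r' ×ˢ Ioo t₁ T,
      ‖ricAt (G q.2) q.1 - (2 * (T - q.2))⁻¹ • G q.2 q.1‖ ≤ C₀ * (T - q.2) ^ δ₀)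
    (hcov : ∀ k : ℕ, ∃ δ C : ℝ, 0 < δ ∧ ∀ q ∈ ball y₀ r' ×ˢ Ioo t₁ T,
      ∀ I : Fin (k + 1) ⊕ Fin 2 → ι,
        |tcovIter (G q.2) b (k + 1) (ric2 (G q.2) b) q.1 I| ≤ C * (T - q.2) ^ δ)
    (m : ℕ) :
    (∃ C : ℝ, ∀ q ∈ ball y₀ r' ×ˢ Ioo t₁ T,
      ‖iteratedFDeriv ℝ m (fun y ↦ (T - q.2)⁻¹ • G q.2 y) q.1‖ ≤ C) ∧
    ∀ η > (0 : ℝ), ∃ t₂ ∈ Ioo t₁ T, ∀ y ∈ ball y₀ r', ∀ t ∈ Ico t₂ T, ∀ t' ∈ Ico t₂ T,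
      ‖iteratedFDeriv ℝ m (fun y ↦ (T - t)⁻¹ • G t y) y
        - iteratedFDeriv ℝ m (fun y ↦ (T - t')⁻¹ • G t' y) y‖ ≤ η := by
  obtain ⟨ε, hε, huG, hDc⟩ := spatiallyBddUpTo_scaled_of_covariantRicciDecay b hfam hfl hr'r
    hball ht₁ hlam hΛ hpos hδ₀ hD hcov m
  have hΩ : IsOpen (ball y₀ r' ×ˢ Ioo t₁ T) := isOpen_ball.prod isOpen_Ioo
  refine ⟨?_, ?_⟩
  · obtain ⟨C, hC⟩ := huG.isBounded m le_rfl
    exact ⟨C, fun q hq ↦ hC q hq⟩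
  -- the weighted defect operator `(T − t)^{−ε} D` is bounded up to order `m`
  set Dop : E × ℝ → (E →L[ℝ] E →L[ℝ] ℝ) := fun q ↦
    (T - q.2) ^ (-ε) • (ricAt (G q.2) q.1 - (2 * (T - q.2))⁻¹ • G q.2 q.1) with hDop
  have hDopB : SpatiallyBddUpTo (ball y₀ r' ×ˢ Ioo t₁ T) m Dop := by
    have hsum := SpatiallyBddUpTo.sum hΩ Finset.univ fun a _ ↦
      SpatiallyBddUpTo.sum hΩ Finset.univ fun c _ ↦ (hDc (pair a c)).smul_const hΩ
        ((ContinuousLinearMap.mul ℝ ℝ).bilinearComp (coordCLM b a) (coordCLM b c))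
    refine hsum.congr hΩ fun q _ ↦ ?_
    simp only [hDop]
    conv_rhs => rw [eq_sum_apply_basis_smul b
      (ricAt (G q.2) q.1 - (2 * (T - q.2))⁻¹ • G q.2 q.1), Finset.smul_sum]
    refine Finset.sum_congr rfl fun a _ ↦ ?_
    rw [Finset.smul_sum]
    refine Finset.sum_congr rfl fun c _ ↦ ?_
    simp only [smul_smul, _root_.sub_apply, _root_.smul_apply, smul_eq_mul, ric2_pair, pair_zero,
      pair_one]
  -- the scaled flow equation: `∂ₜ G̃ = (T − t)^{ε−1} · (−2 Dop)`
  have hIT : Ioo t₁ T ⊆ Ico 0 T := fun t ht ↦ ⟨ht₁.1.trans ht.1.le, ht.2⟩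
  have hsm : ContDiffOn ℝ ∞ (fun q : E × ℝ ↦ (T - q.2)⁻¹ • G q.2 q.1) (ball y₀ r ×ˢ Ioo t₁ T) :=
    ((contDiffOn_const.sub contDiffOn_snd).inv fun q hq ↦ sub_ne_zero.2 (ne_of_gt hq.2.2)).smul
      (hfam.contDiffOn.mono (prod_mono hball hIT))
  have hvB : SpatiallyBddUpTo (ball y₀ r' ×ˢ Ioo t₁ T) m (fun q ↦ (-2 : ℝ) • Dop q) :=
    hDopB.const_smul hΩ (-2)
  have heq : EqOn (dT (fun q : E × ℝ ↦ (T - q.2)⁻¹ • G q.2 q.1))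
      (fun q ↦ (T - q.2) ^ (ε - 1) • ((-2 : ℝ) • Dop q)) (ball y₀ r' ×ˢ Ioo t₁ T) := by
    rintro ⟨y, t⟩ hq
    have hTt : 0 < T - t := sub_pos.2 hq.2.2
    have ht : t ∈ Ioo 0 T := ⟨ht₁.1.trans_lt hq.2.1, hq.2.2⟩
    have hp : (T - t) ^ ε ≠ 0 := (Real.rpow_pos_of_pos hTt ε).ne'
    change deriv (fun s ↦ (T - s)⁻¹ • G s y) t = _
    rw [hfam.deriv_inv_smul_of_flow hfl ht (hball (ball_subset_ball hr'r.le hq.1))]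
    simp only [hDop, smul_smul]
    congr 1
    rw [Real.rpow_sub_one hTt.ne', Real.rpow_neg hTt.le]
    field_simp
  intro η hη
  obtain ⟨t₂, ht₂, h⟩ := dYk_cauchy_of_dT_rpow isOpen_ball isOpen_ball (ball_subset_ball hr'r.le)
    ht₁.2 hε hsm hvB heq m le_rfl η hη
  exact ⟨t₂, ht₂, fun y hy t ht t' ht' ↦ h y hy t ht t' ht'⟩

end MetricCoord

end Literature.Geometry.Lorentzian

/-! ### The manifold: the scaled chart representative of a Ricci flow -/

namespace Literature.Geometry.Riemannian

open Lorentzian Lorentzian.PseudoRiemannianMetric Lorentzian.MetricCoord Literature.Analysis.Calculus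

universe u v w

variable {E : Type u} [NormedAddCommGroup E] [NormedSpace ℝ E] [FiniteDimensional ℝ E]
  [CompleteSpace E] {H : Type v} [TopologicalSpace H] {I : ModelWithCorners ℝ E H} [I.Boundaryless]
  {M : Type w} [TopologicalSpace M] [ChartedSpace H M] [IsManifold I ∞ M]
  {g : ℝ → PseudoRiemannianMetric I ∞ E (TangentSpace I : M → Type _)}
  {cov : ℝ → CovariantDerivative I E (TangentSpace I : M → Type _)} {T : ℝ}

/-- **Uniform `Cᵐ` bounds and the Cauchy property as `t ↑ T` of the scaled chart representative
`G̃(t) = (T − t)⁻¹ · chartRep I g z t` of a Ricci flow** (Hamilton 1982, §14, Lemma 14.2 and §17,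
Cor. 17.10; Topping 2006, pp. 47–48; Chow–Knopf 2004, §6.7). Along a Ricci flow on `[0, T)`,
`T > 0`, chart data at every point `z` — two-sided bounds of `G̃`, decay `C₀(T − t)^{δ₀}` of the
Einstein defect `Ric(G) − G/(2(T − t))` and decay `C_k(T − t)^{δ_k}` of all components of
`∇ᵏ⁺¹Ric` (basis `Module.finBasis ℝ E`) on a closed chart ball `B̄(ẑ, r) × [t₁, T)` — give, on
`B̄(ẑ, r/2)` / `B(ẑ, r/2)` and `[(t₁ + T)/2, T)`, the lower bound, bounds on all `∂ᵐ_y G̃(·, t)`,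
and their uniform Cauchy property as `t ↑ T`. The representative is a coordinate Ricci flow on
`target × [0, T)` (`isMetricFamilyOn_chartRep_of`, `tDeriv_chartRep_eq_of`) and
`MetricCoord.scaled_iteratedFDeriv_bounded_and_cauchy` applies on `B(ẑ, r/2) × (t₁, T)`.
[cite: Hamilton1982, §14, Lemma 14.2] [cite: Hamilton1982, §17, Cor. 17.10]
[cite: Topping2006, §5.3, pp. 47–48] [cite: ChowKnopf2004, §6.7] -/
theorem IsRicciFlow.scaledChartRep_bounded_and_cauchy (hT : 0 < T)
    (hflow : IsRicciFlow g cov (Ico 0 T))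
    (hdata : ∀ z : M, ∃ r t₁ lam Λ : ℝ, 0 < r ∧ t₁ ∈ Ico 0 T ∧ 0 < lam ∧
      closedBall (extChartAt I z z) r ⊆ (extChartAt I z).target ∧
      (∀ t ∈ Ico t₁ T, ∀ y ∈ closedBall (extChartAt I z z) r,
        (∀ v : E, lam * ‖v‖ ^ 2 ≤ (T - t)⁻¹ * chartRep I g z t y v v) ∧
        ‖(T - t)⁻¹ • chartRep I g z t y‖ ≤ Λ) ∧
      (∃ δ₀ C₀ : ℝ, 0 < δ₀ ∧ ∀ t ∈ Ico t₁ T, ∀ y ∈ closedBall (extChartAt I z z) r,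
        ‖ricAt (chartRep I g z t) y - (2 * (T - t))⁻¹ • chartRep I g z t y‖ ≤ C₀ * (T - t) ^ δ₀) ∧
      (∀ k : ℕ, ∃ δk Ck : ℝ, 0 < δk ∧ ∀ t ∈ Ico t₁ T, ∀ y ∈ closedBall (extChartAt I z z) r,
        ∀ J : Fin (k + 1) ⊕ Fin 2 → Fin (finrank ℝ E),
          |tcovIter (chartRep I g z t) (finBasis ℝ E) (k + 1)
            (ric2 (chartRep I g z t) (finBasis ℝ E)) y J| ≤ Ck * (T - t) ^ δk))
    (z : M) :
    ∃ r t₁ lam : ℝ, 0 < r ∧ t₁ ∈ Ico 0 T ∧ 0 < lam ∧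
      closedBall (extChartAt I z z) r ⊆ (extChartAt I z).target ∧
      (∀ t ∈ Ico t₁ T, ∀ y ∈ closedBall (extChartAt I z z) r, ∀ v : E,
        lam * ‖v‖ ^ 2 ≤ (T - t)⁻¹ * chartRep I g z t y v v) ∧
      (∀ m : ℕ, ∃ Cm : ℝ, ∀ t ∈ Ico t₁ T, ∀ y ∈ ball (extChartAt I z z) r,
        ‖iteratedFDeriv ℝ m (fun y : E ↦ (T - t)⁻¹ • chartRep I g z t y) y‖ ≤ Cm) ∧
      (∀ m : ℕ, ∀ ε : ℝ, 0 < ε → ∃ t₂ ∈ Ico t₁ T, ∀ t ∈ Ico t₂ T, ∀ t' ∈ Ico t₂ T,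
        ∀ y ∈ ball (extChartAt I z z) r,
          ‖iteratedFDeriv ℝ m (fun y : E ↦ (T - t)⁻¹ • chartRep I g z t y) y -
            iteratedFDeriv ℝ m (fun y : E ↦ (T - t')⁻¹ • chartRep I g z t' y) y‖ ≤ ε) := by
  obtain ⟨r, t₁, lam, Λ, hr, ht₁, hlam, hball, htwo, ⟨δ₀, C₀, hδ₀, hD⟩, hcov⟩ := hdata z
  set y₀ : E := extChartAt I z z with hy₀
  set b := finBasis ℝ E with hb
  -- the coordinate Ricci flow in the chart at `z` on `target × [0, T)`
  have hS : UniqueDiffOn ℝ (Ico 0 T) := uniqueDiffOn_Ico 0 T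
  have hS' : Ico 0 T ⊆ closure (interior (Ico 0 T)) := by
    rw [interior_Ico, closure_Ioo hT.ne]
    exact Ico_subset_Icc_self
  have hfam : IsMetricFamilyOn (chartRep I g z) (Ico 0 T) (extChartAt I z).target :=
    hflow.isMetricFamilyOn_chartRep_of hS hS' z
  have hfl : ∀ t ∈ Ico 0 T, ∀ y ∈ (extChartAt I z).target,
      tDeriv (chartRep I g z) (Ico 0 T) t y = (-2 : ℝ) • ricAt (chartRep I g z t) y :=
    fun t ht y hy ↦ hflow.tDeriv_chartRep_eq_of hS hS' z ht hy
  -- the smaller ball and the data on the open cylinder `B(ẑ, r/2) × (t₁, T)`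
  set r' : ℝ := r / 2 with hr'
  have hr'pos : 0 < r' := by rw [hr']; positivity
  have hr'r : r' < r := by rw [hr']; linarith
  have hballV : ball y₀ r ⊆ (extChartAt I z).target := ball_subset_closedBall.trans hball
  have hmem : ∀ q ∈ ball y₀ r' ×ˢ Ioo t₁ T, q.2 ∈ Ico t₁ T ∧ q.1 ∈ closedBall y₀ r := fun q hq ↦
    ⟨⟨hq.2.1.le, hq.2.2⟩, ball_subset_closedBall (ball_subset_ball hr'r.le hq.1)⟩
  have hΛ' : ∀ q ∈ ball y₀ r' ×ˢ Ioo t₁ T, ‖(T - q.2)⁻¹ • chartRep I g z q.2 q.1‖ ≤ Λ :=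
    fun q hq ↦ (htwo q.2 (hmem q hq).1 q.1 (hmem q hq).2).2
  have hpos' : ∀ q ∈ ball y₀ r' ×ˢ Ioo t₁ T, ∀ v : E,
      lam * ‖v‖ ^ 2 ≤ (T - q.2)⁻¹ * chartRep I g z q.2 q.1 v v := fun q hq v ↦
    (htwo q.2 (hmem q hq).1 q.1 (hmem q hq).2).1 v
  have hD' : ∀ q ∈ ball y₀ r' ×ˢ Ioo t₁ T,
      ‖ricAt (chartRep I g z q.2) q.1 - (2 * (T - q.2))⁻¹ • chartRep I g z q.2 q.1‖ ≤
        C₀ * (T - q.2) ^ δ₀ := fun q hq ↦ hD q.2 (hmem q hq).1 q.1 (hmem q hq).2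
  have hcov' : ∀ k : ℕ, ∃ δ C : ℝ, 0 < δ ∧ ∀ q ∈ ball y₀ r' ×ˢ Ioo t₁ T,
      ∀ J : Fin (k + 1) ⊕ Fin 2 → Fin (finrank ℝ E),
        |tcovIter (chartRep I g z q.2) b (k + 1) (ric2 (chartRep I g z q.2) b) q.1 J| ≤
          C * (T - q.2) ^ δ := fun k ↦ by
    obtain ⟨δk, Ck, hδk, h⟩ := hcov k
    exact ⟨δk, Ck, hδk, fun q hq J ↦ h q.2 (hmem q hq).1 q.1 (hmem q hq).2 J⟩
  have key := fun m ↦ scaled_iteratedFDeriv_bounded_and_cauchy b hfam hfl hr'r hballV ht₁ hlam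
    hΛ' hpos' hδ₀ hD' hcov' m
  -- the conclusion on `B̄(ẑ, r/2)`, `B(ẑ, r/2)` and `[(t₁ + T)/2, T)`
  refine ⟨r', (t₁ + T) / 2, lam, hr'pos, ⟨by linarith [ht₁.1, ht₁.2], by linarith [ht₁.2]⟩, hlam,
    (closedBall_subset_closedBall hr'r.le).trans hball, ?_, ?_, ?_⟩
  · intro t ht y hy v
    exact (htwo t ⟨by linarith [ht.1, ht₁.2], ht.2⟩ y (closedBall_subset_closedBall hr'r.le hy)).1 v
  · intro m
    obtain ⟨C, hC⟩ := (key m).1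
    exact ⟨C, fun t ht y hy ↦ hC (y, t) ⟨hy, ⟨by linarith [ht.1, ht₁.2], ht.2⟩⟩⟩
  · intro m ε hε
    obtain ⟨t₂, ht₂, h⟩ := (key m).2 ε hε
    refine ⟨max ((t₁ + T) / 2) t₂, ⟨le_max_left _ _, max_lt (by linarith [ht₁.2]) ht₂.2⟩,
      fun t ht t' ht' y hy ↦ ?_⟩
    exact h y hy t ⟨(le_max_right _ _).trans ht.1, ht.2⟩ t' ⟨(le_max_right _ _).trans ht'.1, ht'.2⟩

end Literature.Geometry.Riemannian

end
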